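import Summits.ABC.ABC.Theses.IneffectiveSubspace
import Literature.NumberTheory.DiophantineGeometry.AbcDepthCensus

/-!
# `DeepRegimeABC` (stmt-ABC-15121): certified census of the deep tail — the cells `ω₅ ≥ 7, …, 12` do not meet the boxes `c ≤ 10¹², …, 10²²`

Compute-certificate (line lead `prover-line-stmt-ABC-15121-c1-0`, 2026-08-16; human certificate
objective) for the crux `Summit.ABC.ABC.Theses.IneffectiveSubspace.DeepRegimeABC` — abc with exponent
`1 + ε` on the `ε`-dependent deep tail `{ω₅(abc) ≥ K(ε)}`, `ω₅(n) := #{p : p⁵ ∣ n}` — using the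
soundness-proved enumeration checker `Literature.NumberTheory.DiophantineGeometry.DepthCensus.checkCell`
(`AbcDepthCensus.lean`: every abc triple with `c ≤ N` and `ω₅(abc) ≥ K` is visited by
`checkCell N R K test` whenever `N < (R+1)⁵`; `depth_lt_of_checkCell`).

**Certified here.**  With the always-failing test the checker accepts the six cells/boxes below, i.e. NOT
A SINGLE lattice candidate `A ∣ a, B ∣ b, C ∣ a + b ≤ N` of any depth pattern exists — so a fortiori no
abc triple:

| cell | box | run | depth bound |
|---|---|---|---|
| `ω₅ ≥ 7`  | `c ≤ 10¹²` | `checkCell_seven`  (24 336 patterns)  | `depth_le_six_of_le_tenPow12`    |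
| `ω₅ ≥ 8`  | `c ≤ 10¹⁴` | `checkCell_eight`  (68 580 patterns)  | `depth_le_seven_of_le_tenPow14`  |
| `ω₅ ≥ 9`  | `c ≤ 10¹⁶` | `checkCell_nine`   (132 786 patterns) | `depth_le_eight_of_le_tenPow16`  |
| `ω₅ ≥ 10` | `c ≤ 10¹⁸` | `checkCell_ten`    (115 752 patterns) | `depth_le_nine_of_le_tenPow18`   |
| `ω₅ ≥ 11` | `c ≤ 10²⁰` | `checkCell_eleven` (64 344 patterns)  | `depth_le_ten_of_le_tenPow20`    |
| `ω₅ ≥ 12` | `c ≤ 10²²` | `checkCell_twelve` (7 368 patterns)   | `depth_le_eleven_of_le_tenPow22` |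

Hence (`censusDeepTail`, the registered certificate stub of the crux item): **for every abc triple,
`ω₅(abc) ≤ 6` if `c ≤ 10¹²`, `≤ 7` if `c ≤ 10¹⁴`, `≤ 8` if `c ≤ 10¹⁶`, `≤ 9` if `c ≤ 10¹⁸`, `≤ 10` if
`c ≤ 10²⁰`, `≤ 11` if `c ≤ 10²²`** — the deep cells of the crux begin far out: the cell `{ω₅ ≥ K}` lies
in `{c > 10^(2K-2)}` for `7 ≤ K ≤ 12` (the size bound alone, `4·(p_K#)⁵ ≤ 4abc ≤ c³`, gives only
`c > 5.2·10⁹` for `K = 7` and `c > 1.9·10²⁰` for `K = 12`).  Reading for the crux: whatever the threshold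
`K(ε) ≥ 7` is, the deep tail it selects contains no triple below `10^(2K(ε)-2)` for `K(ε) ≤ 12`; together
with the refuter compute seat's censuses of the cells `ω₅ ≥ 4, 5, 6` (`Negative/CensusBelowTenPowSeven`,
`Negative/ConstFreeFloorsDeep`: records of quality `1.3449 / 1.2184 / 1.1397`) this is the certified part
of the "flat-heavy very-deep core is empty in every searched box" statement of the crux notes.

The only computations trusted to the compiler are the six closed `Bool` equations `checkCell … = true`
(`native_decide`, computational certificate lane); pattern counts and timings (9–23 s each on the farm)
were cross-checked against the independent Python mirror `cert/deep_census.py` of the lead's folder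
(same pattern counts, zero candidates).  Everything else is kernel-checked.
-/

-- `Summit.<Summit>.<Problem>` is the mandated summit-side namespace (CONVENTIONS §2); for the
-- single-conjunct summit `ABC` the two coincide, so the duplicate `ABC.ABC` is deliberate.
set_option linter.dupNamespace false

namespace Summit.ABC.ABC.Theorems.DeepRegimeABC

open Literature.NumberTheory.DiophantineGeometry
open Literature.NumberTheory.DiophantineGeometry.DepthCensus

/-! ## The six compiled runs -/

/-- Cell `ω₅ ≥ 7`, box `10¹²` (`252⁵ > 10¹²`): no lattice candidate. [folklore] -/
theorem checkCell_seven : checkCell (10 ^ 12) 251 7 (fun _ _ _ => false) = true := by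
  native_decide

/-- Cell `ω₅ ≥ 8`, box `10¹⁴` (`631⁵ > 10¹⁴`): no lattice candidate. [folklore] -/
theorem checkCell_eight : checkCell (10 ^ 14) 630 8 (fun _ _ _ => false) = true := by
  native_decide

/-- Cell `ω₅ ≥ 9`, box `10¹⁶` (`1585⁵ > 10¹⁶`): no lattice candidate. [folklore] -/
theorem checkCell_nine : checkCell (10 ^ 16) 1584 9 (fun _ _ _ => false) = true := by
  native_decide

/-- Cell `ω₅ ≥ 10`, box `10¹⁸` (`3982⁵ > 10¹⁸`): no lattice candidate. [folklore] -/
theorem checkCell_ten : checkCell (10 ^ 18) 3981 10 (fun _ _ _ => false) = true := by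
  native_decide

/-- Cell `ω₅ ≥ 11`, box `10²⁰` (`10001⁵ > 10²⁰`): no lattice candidate. [folklore] -/
theorem checkCell_eleven : checkCell (10 ^ 20) 10000 11 (fun _ _ _ => false) = true := by
  native_decide

/-- Cell `ω₅ ≥ 12`, box `10²²` (`25119⁵ > 10²²`): no lattice candidate. [folklore] -/
theorem checkCell_twelve : checkCell (10 ^ 22) 25118 12 (fun _ _ _ => false) = true := by
  native_decide

/-! ## Depth bounds in the boxes -/

/-- **`ω₅(abc) ≤ 6` for every abc triple with `c ≤ 10¹²`.** [folklore] -/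
theorem depth_le_six_of_le_tenPow12 {a b c : ℕ} (habc : IsABCTriple a b c) (hc : c ≤ 10 ^ 12) :
    ((a * b * c).primeFactors.filter (fun p => 5 ≤ (a * b * c).factorization p)).card ≤ 6 :=
  Nat.le_of_lt_succ (depth_lt_of_checkCell (by norm_num) checkCell_seven habc hc)

/-- **`ω₅(abc) ≤ 7` for every abc triple with `c ≤ 10¹⁴`.** [folklore] -/
theorem depth_le_seven_of_le_tenPow14 {a b c : ℕ} (habc : IsABCTriple a b c) (hc : c ≤ 10 ^ 14) :
    ((a * b * c).primeFactors.filter (fun p => 5 ≤ (a * b * c).factorization p)).card ≤ 7 :=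
  Nat.le_of_lt_succ (depth_lt_of_checkCell (by norm_num) checkCell_eight habc hc)

/-- **`ω₅(abc) ≤ 8` for every abc triple with `c ≤ 10¹⁶`.** [folklore] -/
theorem depth_le_eight_of_le_tenPow16 {a b c : ℕ} (habc : IsABCTriple a b c) (hc : c ≤ 10 ^ 16) :
    ((a * b * c).primeFactors.filter (fun p => 5 ≤ (a * b * c).factorization p)).card ≤ 8 :=
  Nat.le_of_lt_succ (depth_lt_of_checkCell (by norm_num) checkCell_nine habc hc)

/-- **`ω₅(abc) ≤ 9` for every abc triple with `c ≤ 10¹⁸`.** [folklore] -/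
theorem depth_le_nine_of_le_tenPow18 {a b c : ℕ} (habc : IsABCTriple a b c) (hc : c ≤ 10 ^ 18) :
    ((a * b * c).primeFactors.filter (fun p => 5 ≤ (a * b * c).factorization p)).card ≤ 9 :=
  Nat.le_of_lt_succ (depth_lt_of_checkCell (by norm_num) checkCell_ten habc hc)

/-- **`ω₅(abc) ≤ 10` for every abc triple with `c ≤ 10²⁰`.** [folklore] -/
theorem depth_le_ten_of_le_tenPow20 {a b c : ℕ} (habc : IsABCTriple a b c) (hc : c ≤ 10 ^ 20) :
    ((a * b * c).primeFactors.filter (fun p => 5 ≤ (a * b * c).factorization p)).card ≤ 10 :=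
  Nat.le_of_lt_succ (depth_lt_of_checkCell (by norm_num) checkCell_eleven habc hc)

/-- **`ω₅(abc) ≤ 11` for every abc triple with `c ≤ 10²²`.** [folklore] -/
theorem depth_le_eleven_of_le_tenPow22 {a b c : ℕ} (habc : IsABCTriple a b c) (hc : c ≤ 10 ^ 22) :
    ((a * b * c).primeFactors.filter (fun p => 5 ≤ (a * b * c).factorization p)).card ≤ 11 :=
  Nat.le_of_lt_succ (depth_lt_of_checkCell (by norm_num) checkCell_twelve habc hc)

/-- The same, read as where the deep cells begin: an abc triple with `ω₅(abc) ≥ K`, `7 ≤ K ≤ 12`, has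
`c > 10^(2K-2)`. [folklore] -/
theorem tenPow_lt_of_le_depth {a b c K : ℕ} (habc : IsABCTriple a b c) (h7 : 7 ≤ K) (h12 : K ≤ 12)
    (hK : K ≤ ((a * b * c).primeFactors.filter (fun p => 5 ≤ (a * b * c).factorization p)).card) :
    10 ^ (2 * K - 2) < c := by
  by_contra hle
  rw [not_lt] at hle
  interval_cases K
  · exact absurd (hK.trans (depth_le_six_of_le_tenPow12 habc hle)) (by norm_num)
  · exact absurd (hK.trans (depth_le_seven_of_le_tenPow14 habc hle)) (by norm_num)
  · exact absurd (hK.trans (depth_le_eight_of_le_tenPow16 habc hle)) (by norm_num)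
  · exact absurd (hK.trans (depth_le_nine_of_le_tenPow18 habc hle)) (by norm_num)
  · exact absurd (hK.trans (depth_le_ten_of_le_tenPow20 habc hle)) (by norm_num)
  · exact absurd (hK.trans (depth_le_eleven_of_le_tenPow22 habc hle)) (by norm_num)

/-! ## Registered certificate stub of the crux item (stmt-ABC-15121) -/

/-- **Registered certificate `censusDeepTail`** (crux `DeepRegimeABC`, line SketchIdeator5R2, human
certificate objective): the deep cells `{ω₅ ≥ 7}, …, {ω₅ ≥ 12}` of the crux contain no abc triple with
`c ≤ 10¹², …, 10²²` respectively. [folklore] -/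
theorem censusDeepTail : (∀ a b c : ℕ, Literature.NumberTheory.DiophantineGeometry.IsABCTriple a b c → c ≤ 10 ^ 12 → ((a * b * c).primeFactors.filter (fun p => 5 ≤ (a * b * c).factorization p)).card ≤ 6) ∧ (∀ a b c : ℕ, Literature.NumberTheory.DiophantineGeometry.IsABCTriple a b c → c ≤ 10 ^ 14 → ((a * b * c).primeFactors.filter (fun p => 5 ≤ (a * b * c).factorization p)).card ≤ 7) ∧ (∀ a b c : ℕ, Literature.NumberTheory.DiophantineGeometry.IsABCTriple a b c → c ≤ 10 ^ 16 → ((a * b * c).primeFactors.filter (fun p => 5 ≤ (a * b * c).factorization p)).card ≤ 8) ∧ (∀ a b c : ℕ, Literature.NumberTheory.DiophantineGeometry.IsABCTriple a b c → c ≤ 10 ^ 18 → ((a * b * c).primeFactors.filter (fun p => 5 ≤ (a * b * c).factorization p)).card ≤ 9) ∧ (∀ a b c : ℕ, Literature.NumberTheory.DiophantineGeometry.IsABCTriple a b c → c ≤ 10 ^ 20 → ((a * b * c).primeFactors.filter (fun p => 5 ≤ (a * b * c).factorization p)).card ≤ 10) ∧ (∀ a b c : ℕ, Literature.NumberTheory.DiophantineGeometry.IsABCTriple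 a b c → c ≤ 10 ^ 22 → ((a * b * c).primeFactors.filter (fun p => 5 ≤ (a * b * c).factorization p)).card ≤ 11) :=
  ⟨fun _ _ _ h hc => depth_le_six_of_le_tenPow12 h hc,
    fun _ _ _ h hc => depth_le_seven_of_le_tenPow14 h hc,
    fun _ _ _ h hc => depth_le_eight_of_le_tenPow16 h hc,
    fun _ _ _ h hc => depth_le_nine_of_le_tenPow18 h hc,
    fun _ _ _ h hc => depth_le_ten_of_le_tenPow20 h hc,
    fun _ _ _ h hc => depth_le_eleven_of_le_tenPow22 h hc⟩

end Summit.ABC.ABC.Theorems.DeepRegimeABC
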